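import Summits.BirchSwinnertonDyer.Rank1Residual.F1Sign2.IntrinsicDeepTwistLawsAtTwo
import HarnessLib

/-!
# Cell `bsd-f1-sign2`, DESC-§23♯-WIDE: wide-window siblings of the intrinsic deep-twist rows (TY♯), (TR♯) (-desc g15 on REF1 §117 r4; CANDIDATES-delta DESC v23.11, D-desc-49)

TYPER FILING (cell `bsd-f1-sign2`, seat `-ty` g10; -desc g15 filing ask D-desc-49 (15:07:41Z) «file as sibling `F1Sign2/IntrinsicDeepTwistLawsAtTwoWide.lean` =
`MEMO-desc-data/g15/lean/SketchG15IntrinsicWide.lean` 41f30fbbd250b7d4 VERBATIM; both rows `@[conjecture]` (data-only at f > e + 2)»; farm rc 0 · 0 · 0 · 0;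
BC7 2/2 CLEAN `ProbeG15IntrinsicWide.verdict.out` 0d9a167d7ee75a23): the sketch body VERBATIM — same flat namespace `…Rank1Residual.F1Sign2`, one
import (the tree file `F1Sign2.IntrinsicDeepTwistLawsAtTwo`, p642939: carriers `ordAt`, `ramificationIdxOverTwo`, `twoTorsionRootCountAt` and the
NARROW rows).  Decls: `IntrinsicDeepTwistNeronTypeLawAtTwoWide` (TY♯-wide: window `2 ≤ f_v(E) ≤ 2e + 2`, no `0 ≤ ord_v j_E`),
`IntrinsicDeepTwistTamagawaRatioLawAtTwoWide` (TR♯-wide), both `@[conjecture]` (typer edit per D-desc-49: attribute only), and the PROVED glue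
`intrinsicDeepTwistNeronTypeLawAtTwo_of_wide`, `intrinsicDeepTwistTamagawaRatioLawAtTwo_of_wide` (wide ⟹ the filed narrow rows; `omega`).
APPEND-ONLY DISCIPLINE (REF1 §117 r4): the narrow rows stay as filed (they carry the words-proofs and are the tower-relevant ones, `f ≤ e + 2` ⟸
upper break `≤ e/2`); these are new names in a new file.  Typer edits = this header, the two attributes, the REF1, REF2 sentences.  Nothing is
asserted: `def … : Prop` only.
Census = BC5 WITNESS: REF1 §117 `mutate117.py` on -desc kit j310143 (`tw5-all-j310143.out` 7b8961ed9262f102; 60 032 curves over five fields with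
`e ∈ {2, 4}`, seven (field, uniformiser) pairs): window `2 ≤ f ≤ 2e + 2`, `0 ≤ ord j` dropped — (TY♯-wide) (a) 10 021/10 021, (b) 28 539/28 539,
(c) 8 615/8 615; (TR♯-wide) 6 464/6 464; the first (b)-failures sit exactly at `f = 2e + 3` (both-in-𝔭 reduced charts; conjecture (CH), r3: one
kit job at `e = 6, 8` owed by -data); -desc BC7 probe 2/2 CLEAN.
REF1-AUDIT §117 r4 (refuter-bsd-f1-sign2-ref1 g10, 2026-08-28T14:48:15Z; `HOME/REF1-data/b117/mutate117.out`): «the window `3 ≤ f ≤ e+2` can be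
widened to `2 ≤ f ≤ 2e+2` with 0 failures in all four clauses on j310143; `0 ≤ ord j` is not needed by (b), (TR) on this census; if a wide sibling
is typed, keep the narrow rows (they are the ones with words-proofs attached) and add the wide ones append-only» — this file IS that sibling (typed
by -desc g15 15:07:41Z, cc -ref1: «r4 done as typed rows»); a landing certificate of the two typed rows by -ref1 g11 is welcome (A1 shape = the
narrow rows with two bounds changed; glue kernel-checked).
REF2-PLACEMENT (inherited from the narrow rows, v31 §2.2 + v32 §2): (TY♯) KNOWN on the quadratic-semistable sub-family (Wang 2024 Cor. 2.12, Thm 1.2;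
Lorenzini 2010 Thm 2.8), VARIANT beyond; (TR♯) as typed not in print as stated; at `f > e + 2` the rows are DATA ONLY (no tower heuristic, no
words-proof) — conjecture-grade; beyond-print no.  A REF2 g33 slot read is welcome.
PARTITION: none moved (frontier tier); beyond-print theorem: no.  BSD is not proved by any of this.
bears_on: F1Sign2 leaf (intrinsic rows `IntrinsicDeepTwistLawsAtTwo.lean` p642939 ⟸ `DeepTwistLawsAtTwo.lean` p640583 ⟸ IMC-LTS); asks D-desc-49 (-ty,
this file), REF1 §117 r3 (CH) kit job (-data).

## The sketch's own summary (verbatim)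

# WIDE-WINDOW siblings of the intrinsic deep-twist rows (TY♯), (TR♯) — -desc g15 on REF1 §117 r4

REF1 §117 (mutate117 on kit j310143 `tw5-all.out` 7b8961ed9262f102): replacing the window `3 ≤ f_v(E) ≤ e + 2` of
`IntrinsicDeepTwistNeronTypeLawAtTwo` / `IntrinsicDeepTwistTamagawaRatioLawAtTwo` by `2 ≤ f_v(E) ≤ 2e + 2` and dropping
`0 ≤ ord_v j_E` costs nothing: (TY♯)(a) 10 021/10 021, (b) 28 539/28 539, (c) 8 615/8 615, (TR♯) 6 464/6 464; the first
(b)-failures sit exactly at `f = 2e + 3` (the both-in-`𝔭` reduced charts, conjecture (CH)).  The narrow rows stay as filed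
(they are the tower-relevant ones: `f ≤ e + 2` ⟸ upper break `≤ e/2`); these wide rows are append-only siblings under new
names, same carriers (`ordAt`, `ramificationIdxOverTwo`, `twoTorsionRootCountAt` of the tree file).
-/

noncomputable section

open scoped Classical NumberField
open WeierstrassCurve IsDedekindDomain NumberField

namespace Summit.BirchSwinnertonDyer.Rank1Residual.F1Sign2

/-- **(TY♯-wide)** `IntrinsicDeepTwistNeronTypeLawAtTwo` with the window widened to `2 ≤ f_v(E) ≤ 2e + 2` and without
`0 ≤ ord_v j_E` (REF1 §117 r4: (a) 10 021/10 021, (b) 28 539/28 539, (c) 8 615/8 615 on kit j310143; first failures of (b) at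
`f = 2e + 3`).  Why it might fail: fields with `e ∉ {2, 4}` unsampled; at `f = 2e + 2` the curve need not be a deep layer of
any tower, so the tower heuristics give no support — data only.
D-desc-49, REF1 §117 r4: conjecture-grade, tagged `@[conjecture]` (typer edit: attribute only); implies the filed narrow row
(`intrinsicDeepTwistNeronTypeLawAtTwo_of_wide` below).
LANDING NOTE (-ty g11, 2026-08-28; director's rule: first word «misstated»): misstated — the `IsSquare Δ_v → I₀*` conjunct of CLAUSE (a) of this row is
FALSE at places of EVEN residue degree (MEMO-desc §24.6, D-desc-57; REF2 v37 §1 AGREE refuted-MISSTATED; witness K = ℚ(√2,√−3), v ∣ 2 unique, e = 2,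
k_v = 𝔽₄, δ = 2+√2, E = W_K for each of 1 475 class-(a) W/ℚ with Δ_W ∈ −3ℚ₂^{×2}, 2 ≤ f₂ ≤ 6: every hypothesis holds, Δ ∈ K_v^{×2}, the row says I₀*,
truth = II/II*, smallest witness 88a1; at even residue degree `Δ_E ∈ K_v^{×2}` does not detect the unramified cubic).  REPAIRED STATEMENT (new name,
append-only; this decl stays as a negative edge): `IntrinsicDeepTwistNeronTypeLawAtTwoClassAOdd` (odd residue degree; window f ≤ 4e+1; no parity-of-e) in
`F1Sign2/NoTwoTorsionDeepTwistLawsAtTwo.lean`, derived by kernel glue from THEOREM Φ `NoTwoTorsionDeepTwistNeronLawAtTwo` (the residue trichotomy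
`ord_v Δ_E ≡ 4e / 4e−4 / 4e+4 (mod 12)`, any residue degree; REF1 §131).  Clauses (b), (c) and the rows (F♯)/(TR♯) are unaffected. -/
@[conjecture] def IntrinsicDeepTwistNeronTypeLawAtTwoWide : Prop :=
  ∀ (K : Type) [Field K] [NumberField K] (v : HeightOneSpectrum (𝓞 K)), (2 : 𝓞 K) ∈ v.asIdeal →
    Even (ramificationIdxOverTwo v) →
    ∀ (E : WeierstrassCurve K) [E.IsElliptic], 2 ≤ E.conductorExponent v →
      E.conductorExponent v ≤ 2 * ramificationIdxOverTwo v + 2 →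
      ∀ δ : K, ordAt v δ = 1 →
        (twoTorsionRootCountAt v E = 0 →
          (E.quadraticTwist δ).tamagawaNumberAt v = 1 ∧
          (IsSquare (algebraMap K (v.adicCompletion K) E.Δ) → (E.quadraticTwist δ).kodairaSymbolAt v = .Istar 0) ∧
          (¬ IsSquare (algebraMap K (v.adicCompletion K) E.Δ) →
            ((8 * (ramificationIdxOverTwo v : ℤ) + ordAt v E.Δ) % 12 = 8 → (E.quadraticTwist δ).kodairaSymbolAt v = .II) ∧
            ((8 * (ramificationIdxOverTwo v : ℤ) + ordAt v E.Δ) % 12 = 4 → (E.quadraticTwist δ).kodairaSymbolAt v = .IIstar))) ∧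
        (twoTorsionRootCountAt v E ≠ 0 →
          (E.quadraticTwist δ).kodairaSymbolAt v =
            .Istar (if E.j = 0 then 0 else (8 * (ramificationIdxOverTwo v : ℤ) - ordAt v E.j).toNat)) ∧
        ((E.quadraticTwist δ).kodairaSymbolAt v = .Istar 0 →
          (E.quadraticTwist δ).tamagawaNumberAt v = twoTorsionRootCountAt v E + 1)

/-- **(TR♯-wide)** `IntrinsicDeepTwistTamagawaRatioLawAtTwo` with the window widened to `2 ≤ f_v(E) ≤ 2e + 2` and without
`0 ≤ ord_v j_E` (REF1 §117 r4: 6 464/6 464 on kit j310143, fields `ℚ(√2)` {`√2`, `2+√2`} and `ℚ(ζ₃₂)⁺` {`β₃`, `2+β₃`}).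
Why it might fail: as (TY♯-wide); only Galois-over-`ℚ` fields with two uniformiser classes sampled.
D-desc-49, REF1 §117 r4: conjecture-grade, tagged `@[conjecture]` (typer edit: attribute only); implies the filed narrow row
(`intrinsicDeepTwistTamagawaRatioLawAtTwo_of_wide` below). -/
@[conjecture] def IntrinsicDeepTwistTamagawaRatioLawAtTwoWide : Prop :=
  ∀ (K : Type) [Field K] [NumberField K] (v : HeightOneSpectrum (𝓞 K)), (2 : 𝓞 K) ∈ v.asIdeal →
    Even (ramificationIdxOverTwo v) →
    ∀ (E : WeierstrassCurve K) [E.IsElliptic], ordAt v E.j < 8 * (ramificationIdxOverTwo v : ℤ) →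
      2 ≤ E.conductorExponent v → E.conductorExponent v ≤ 2 * ramificationIdxOverTwo v + 2 →
      twoTorsionRootCountAt v E ≠ 0 →
      ∀ δ₁ δ₂ : K, ordAt v δ₁ = 1 → ordAt v δ₂ = 1 →
        ((E.quadraticTwist δ₁).tamagawaNumberAt v = (E.quadraticTwist δ₂).tamagawaNumberAt v ↔
          ∃ x y : v.adicCompletion K,
            x ^ 2 - algebraMap K (v.adicCompletion K) E.Δ * y ^ 2 = algebraMap K (v.adicCompletion K) (δ₁ * δ₂))

/-- Glue (kernel-checked): the wide Néron-type row implies the filed narrow one (`e + 2 ≤ 2e + 2`, `3 ≤ f ⟹ 2 ≤ f`). -/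
theorem intrinsicDeepTwistNeronTypeLawAtTwo_of_wide (h : IntrinsicDeepTwistNeronTypeLawAtTwoWide) :
    IntrinsicDeepTwistNeronTypeLawAtTwo := by
  intro K _ _ v hv he E _ _hj h3 hf δ hδ
  exact h K v hv he E (by omega) (by omega) δ hδ

/-- Glue (kernel-checked): the wide ratio row implies the filed narrow one. -/
theorem intrinsicDeepTwistTamagawaRatioLawAtTwo_of_wide (h : IntrinsicDeepTwistTamagawaRatioLawAtTwoWide) :
    IntrinsicDeepTwistTamagawaRatioLawAtTwo := by
  intro K _ _ v hv he E _ _hj hj8 h3 hf ht δ₁ δ₂ h₁ h₂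
  exact h K v hv he E hj8 (by omega) (by omega) ht δ₁ δ₂ h₁ h₂

end Summit.BirchSwinnertonDyer.Rank1Residual.F1Sign2
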